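import Literature.AlgebraicGeometry.Resolution.KnafKuhlmann2005Thm34HenselRoot
import Literature.AlgebraicGeometry.Resolution.AbhyankarToroidalChartsInertial
import Literature.AlgebraicGeometry.Resolution.AbhyankarBases
import Literature.AlgebraicGeometry.Resolution.KnafKuhlmann2009Prop23
import HarnessLib

/-!
# Knaf–Kuhlmann 2005, Thm. 3.4 (inertial generation of Abhyankar places) from the Generalized Stability Theorem

Topic: `Literature/AlgebraicGeometry/Resolution`. A step of the decomposition of the named fact
`KnafKuhlmann2005_Thm11` (Knaf–Kuhlmann 2005, Thm. 1.1: `K`-trivial Abhyankar places with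
separable residue field extension admit local uniformization with a smooth centre;
`FiniteExtensionUniformization.lean`). Knaf–Kuhlmann prove Thm. 1.1 from

* Thm. 3.1, the **Generalized Stability Theorem** ([K1] = Kuhlmann 2010, Thm. 1.1; the tree's
  named fact `Kuhlmann2010Stability`, `ValuationDefect.lean`), through
* Thm. 3.4 (**inertial generation**: `F` lies in the absolute inertia field of `K(x, y)` for an
  Abhyankar transcendence basis with `v_P F = ⊕ ℤ v_P xᵢ` and `yP` a separating transcendence
  basis of `FP|KP`; the tree's named facts `KnafKuhlmann2005_Thm34_etale` ≃
  `KnafKuhlmann2005_Thm34_henselRoot`), and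
* §4 (Thm. 4.1, the rational case) and §5 (Lemma 5.1, étale ascent), PROVED in the tree
  (`AbhyankarRationalUniformization.lean`, `AbhyankarEtaleAscent.lean`:
  `KnafKuhlmann2005_Thm11.of_parts`, `KnafKuhlmann2005_Thm11.of_henselRoot`).

This file PROVES the remaining implication **Thm. 3.1 ⇒ Thm. 3.4** (for a `K`-trivial place, in
Hensel-root form):

* `KnafKuhlmann2005_Thm34_henselRoot.of_stability :
    Kuhlmann2010Stability → KnafKuhlmann2005_Thm34_henselRoot`,

so that the trust base of `KnafKuhlmann2005_Thm34_henselRoot`, `KnafKuhlmann2005_Thm34_etale` and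
`KnafKuhlmann2005_Thm11` becomes `{Kuhlmann2010Stability}`
(`KnafKuhlmann2005_Thm34_etale.of_stability`, `KnafKuhlmann2005_Thm11.of_stability`, and the
variants `.of_stabilityRational`, `.of_stabilityValueTranscendental` along the tree's reductions
of the stability theorem), and that of `KnafKuhlmann2009_Thm12` / `KnafKuhlmann2009` becomes
`{KnafKuhlmann2009_Thm38_sepClosed, Kuhlmann2010Stability}`
(`KnafKuhlmann2009_Thm12.of_thm38_stability`, `KnafKuhlmann2009.of_thm38_stability`). The
discharge `KnafKuhlmann2005_Thm11_holds` is then the one line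
`KnafKuhlmann2005_Thm11.of_stability Kuhlmann2010Stability_holds` once the stability theorem is
discharged.

## The proof

The printed proof of Thm. 3.4 (KK05 p. 7): by Cor. 2.2 choose `x₁,…,x_ρ` with
`v_P F = v_P K ⊕ ℤv_P x₁ ⊕ … ⊕ ℤv_P x_ρ` and `y₁,…,y_τ` with `FP|KP(yP)` separable-algebraic,
`F₀ := K(x, y)`; "`(F₀|K,P)` is without transcendence defect … Hence we know from Theorem 3.1
that `(F₀(η),P)` is a defectless field", and with Hensel's Lemma and Cor. 3.3 `F ⊆ F₀(η)^h` lies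
in the absolute inertia field of `F₀`. The valuation theory of the last step — a finite extension
of a DEFECTLESS valued field with `e = 1` and separable residue field extension is generated by a
Hensel root `η` (minimal polynomial over the valuation ring with unit derivative at `η`) — is
PROVED in the tree in the type rendering (`exists_generator_valuation_derivative_eq_one`,
`UnramifiedDefectlessGenerator.lean`; packaged with the stability theorem as
`Temkin2013_Thm551iii_inertial.of_stability`, `AbhyankarToroidalChartsInertial.lean`), as are
adapted Abhyankar bases (`exists_adapted_isAbhyankarBasis`, `AbhyankarBases.lean`). What this file
supplies is the passage between the AMBIENT rendering of the KK05 facts (subfields `K ≤ F` of a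
valued field `(Ω, V)`, `IsAbhyankarPlace`, `SeparablyGeneratedOver (resField V K) (resField V F)`)
and the TYPE rendering of the stability theorem (`k ⊆ K°`, `transcendenceDefect k O hk = 0`):

* `transcendenceDefect_comap_eq_zero_of_isAbhyankarPlace` — for `F` presented as an intermediate
  field `M` of `Ω|K`, `D_{M/K} = 0` for `O_V ∩ M` (KK05 Thm. 2.1, ambient form
  `algebraicIndependent_sumElim_of_valIndep`: the Abhyankar elements are a transcendence basis, so
  `trdeg = ρ + τ ≤ E + F`).
* `exists_isTranscendenceBasis_residueField_of_separablyGeneratedOver` — the residue field of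
  `O_V ∩ M` has a finite transcendence basis over `K` over which it is separable (transport of the
  separating transcendence basis of `FP|KP` along `κ(O_V ∩ M) → κ(O_V)`, whose image is
  `resField V F`, and along `K ≅ KP = resField V K`).
* `KnafKuhlmann2005_Thm34_henselRoot.of_stability` — assembly: adapted Abhyankar basis `(x, y)`
  (`|x|` a `ℤ`-basis of `vF`, `yP` the separating transcendence basis), the Hensel-root generator
  `η` of `F|K(x, y)` from the stability theorem, and the data read back in `Ω` (values are
  `ℤ`-independent modulo `vK = 1`, residues algebraically independent over `KP`,
  `F = K(x, y)(η)`, `f :=` the minimal polynomial mapped to `Ω[X]`).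

## Sources

* [KK05] H. Knaf, F.-V. Kuhlmann, *Abhyankar places admit local uniformization in any
  characteristic*, Ann. Sci. ÉNS 38 (2005) 833–846 = arXiv:math/0304159: Thm. 2.1 and Cor. 2.2
  (p. 6 of the arXiv text), Thm. 3.1, Lemma 3.2, Cor. 3.3, Thm. 3.4 and its proof (p. 7),
  proof of Thm. 1.1 (p. 13).
* [K1] F.-V. Kuhlmann, *Elimination of ramification I: The generalized stability theorem*,
  Trans. AMS 362 (2010) 5697–5727, Thm. 1.1.
* M. Temkin, *Inseparable local uniformization*, J. Algebra 373 (2013) 65–119 =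
  arXiv:0804.1554v3, proof of Thm. 5.5.1 (iii) (p. 59) — the same argument in Temkin's setting,
  whose tree formalization is reused here.
-/

noncomputable section

namespace Literature.AlgebraicGeometry.Resolution

universe u

open IsLocalRing ValuationSubring Polynomial Cardinal
open scoped IntermediateField

variable {Ω : Type u} [Field Ω]

/-! ## From the ambient rendering to the type rendering -/

section Bridge

variable (V : ValuationSubring Ω) {K F : Subfield Ω}

/-- `K ⊆ O_V` in the form `∀ c : K, algebraMap K Ω c ∈ V`. [folklore] -/
theorem algebraMap_subfield_mem_of_subset (hKV : (K : Set Ω) ⊆ V) (c : K) :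
    algebraMap K Ω c ∈ V :=
  hKV c.2

/-- `K ⊆ O_V ∩ M` for an intermediate field `M` of `Ω|K`. [folklore] -/
theorem algebraMap_mem_comap_intermediateField (M : IntermediateField K Ω)
    (hKV : (K : Set Ω) ⊆ V) (c : K) :
    algebraMap K M c ∈ V.comap (algebraMap M Ω) := by
  rw [ValuationSubring.mem_comap, ← IsScalarTower.algebraMap_apply]
  exact hKV c.2

/-- Value-independence (`IsValueIndependent`) of `x₁, …, x_ρ` from the `ℤ`-independence of
their values modulo the value group of a subfield `K` (test with `b = 1 ∈ K`). [folklore] -/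
theorem isValueIndependent_of_valIndep (K : Subfield Ω) {ρ : ℕ} {x : Fin ρ → Ω}
    (hx0 : ∀ i, x i ≠ 0)
    (hxi : ∀ m : Fin ρ → ℤ,
      (∃ b ∈ K, (∏ i, V.valuation (x i) ^ (m i)) = V.valuation b) → m = 0) :
    IsValueIndependent V x := by
  classical
  refine ⟨hx0, fun s g hsg j hj => ?_⟩
  set m : Fin ρ → ℤ := fun i => if i ∈ s then g i else 0 with hm
  have hprod : (∏ i, V.valuation (x i) ^ (m i)) = V.valuation (∏ j ∈ s, x j ^ g j) := by
    rw [map_prod]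
    simp_rw [map_zpow₀]
    rw [← Finset.prod_subset (Finset.subset_univ s)]
    · exact Finset.prod_congr rfl fun i hi => by simp [hm, hi]
    · intro i _ hi
      simp [hm, hi]
  have h := hxi m ⟨1, K.one_mem, by rw [hprod, hsg, map_one]⟩
  have := congr_fun h j
  simpa [hm, hj] using this

/-- Algebraicity over `K(b)` computed in `Ω` gives algebraicity over `K(b)` computed in an
intermediate field `M ∋ bᵢ` (companion of `isSeparable_adjoin_intermediateField`). [folklore] -/
theorem isAlgebraic_adjoin_intermediateField (M : IntermediateField K Ω) {ι : Type*}
    (b : ι → M) {m : M}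
    (h : IsAlgebraic (IntermediateField.adjoin K (Set.range fun i => (b i : Ω))) (m : Ω)) :
    IsAlgebraic (IntermediateField.adjoin K (Set.range b)) m := by
  set A := IntermediateField.adjoin K (Set.range b) with hA
  have himage : Subtype.val '' Set.range b = Set.range fun i => (b i : Ω) := by
    rw [← Set.range_comp]; rfl
  have hlift : IntermediateField.lift A =
      IntermediateField.adjoin K (Set.range fun i => (b i : Ω)) := by
    rw [hA, IntermediateField.lift_adjoin, himage]
  let f : A →+* IntermediateField.adjoin K (Set.range fun i => (b i : Ω)) :=
    { toFun := fun w => ⟨((w : M) : Ω), by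
        rw [← hlift]; exact (IntermediateField.mem_lift (w : M)).mpr w.2⟩
      map_one' := rfl
      map_mul' := fun _ _ => rfl
      map_zero' := rfl
      map_add' := fun _ _ => rfl }
  have hf : Function.Surjective f := by
    intro w
    have hw : (w : Ω) ∈ IntermediateField.lift A := by rw [hlift]; exact w.2
    exact ⟨⟨⟨w, IntermediateField.lift_le A hw⟩, (IntermediateField.mem_lift _).mp hw⟩,
      Subtype.ext rfl⟩
  exact IsAlgebraic.of_ringHom_of_comp_eq f (algebraMap M Ω) h hf (algebraMap M Ω).injective
    (RingHom.ext fun _ => rfl)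

/-- **`D = 0` for an Abhyankar place, in the type rendering.** For `K ≤ F ⊆ Ω`, `K ⊆ O_V`, an
Abhyankar place (`IsAbhyankarPlace V K F`) and an intermediate field `M` of `Ω|K` with the same
elements as `F`, finitely generated over `K`: the transcendence defect of `(M, O_V ∩ M)` over the
trivially valued `K` vanishes (Knaf–Kuhlmann 2005, Thm. 2.1 and inequality (1): `x, y` are
algebraically independent, so `ρ + τ = trdeg`, `ρ ≤ E`, `τ ≤ F`, `E + F ≤ trdeg`).
[cite: KnafKuhlmann2005, Thm. 2.1 and Section 1 (inequality (1))] -/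
theorem transcendenceDefect_comap_eq_zero_of_isAbhyankarPlace (M : IntermediateField K Ω)
    (hMF : ∀ z, z ∈ M ↔ z ∈ F) (hKV : (K : Set Ω) ⊆ V)
    (hfgM : (⊤ : IntermediateField K M).FG) (hA : IsAbhyankarPlace V K F) :
    transcendenceDefect K (V.comap (algebraMap M Ω))
      (algebraMap_mem_comap_intermediateField V M hKV) = 0 := by
  classical
  obtain ⟨ρ, τ, x, y, hy, hx, hyF, hxi, hri, halg⟩ := hA
  set O := V.comap (algebraMap M Ω) with hO
  have hk : ∀ c : K, algebraMap K M c ∈ O := algebraMap_mem_comap_intermediateField V M hKV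
  have hKV' : ∀ c : K, algebraMap K Ω c ∈ V := fun c => hKV c.2
  -- the families inside `M`
  let xM : Fin ρ → M := fun i => ⟨x i, (hMF _).mpr (hx i).1⟩
  let yM : Fin τ → O := fun j =>
    ⟨⟨y j, (hMF _).mpr (hyF j)⟩, ValuationSubring.mem_comap.mpr (hy j)⟩
  have hN : Algebra.trdeg K M < ℵ₀ := trdeg_lt_aleph0_of_fg hfgM
  refine (transcendenceDefect_eq_zero_iff O hk hN).mpr
    (le_antisymm (ratRank_add_residueTrdeg_le_trdeg O hk) ?_)
  -- (1) `trdeg K M = ρ + τ`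
  have hind : AlgebraicIndependent K (Sum.elim x y) :=
    algebraicIndependent_sumElim_of_valIndep V K x y (fun i => (hx i).2) hxi hy hri
  let b : Fin ρ ⊕ Fin τ → M := Sum.elim xM fun j => ((yM j : M))
  have hbval : (fun i => (b i : Ω)) = Sum.elim x y := by
    funext i; rcases i with i | j <;> rfl
  have hbind : AlgebraicIndependent K b := by
    refine AlgebraicIndependent.of_comp M.val ?_
    have : ⇑M.val ∘ b = Sum.elim x y := by funext i; rcases i with i | j <;> rfl
    rw [this]; exact hind
  have hrange : (Set.range fun i => (b i : Ω)) = Set.range x ∪ Set.range y := by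
    rw [hbval, Set.Sum.elim_range]
  have hB : IsTranscendenceBasis K b := by
    refine hbind.isTranscendenceBasis_iff_isAlgebraic.mpr
      (IntermediateField.isAlgebraic_adjoin_iff_top.mp ⟨fun m => ?_⟩)
    apply isAlgebraic_adjoin_intermediateField M b
    rw [hrange]
    exact halg (m : Ω) ((hMF _).mp m.2)
  have htr : Algebra.trdeg K M = ((ρ + τ : ℕ) : Cardinal) := by
    have h := hB.lift_cardinalMk_eq_trdeg
    simp only [Cardinal.mk_fintype, Fintype.card_sum, Fintype.card_fin, Cardinal.lift_natCast,
      Cardinal.lift_uzero] at h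
    exact h.symm
  -- (2) `ρ ≤ E`
  have hE : (ρ : Cardinal) ≤ ratRank O := by
    have hvi : IsValueIndependent V x := isValueIndependent_of_valIndep V K (fun i => (hx i).2) hxi
    have h := (isValueIndependent_comap_iff V xM).mpr hvi
    exact h.natCast_le_ratRank
  -- (3) `τ ≤ F`
  have hF : (τ : Cardinal) ≤ residueTrdeg K O hk := by
    refine natCast_le_residueTrdeg_comap K V hKV' hk yM ?_
    letI := algebraOfMem K V hKV'
    -- base change from `resField V K` to `K`
    obtain ⟨φ, -, hφs, hφ, -⟩ :=
      exists_residue_ringHoms V K (F := K) le_rfl (fun z hz => hKV hz)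
    have hcomp : (fun j => residue V (comapInclusion V (yM j))) =
        fun j => residue V ⟨y j, hy j⟩ := by
      funext j; rfl
    rw [hcomp]
    refine AlgebraicIndependent.of_ringHom_of_comp_eq φ (RingHom.id (ResidueField V))
      (by simpa using hri) φ.injective ?_
    ext c
    exact hφ c
  calc Algebra.trdeg K M = ((ρ + τ : ℕ) : Cardinal) := htr
    _ = (ρ : Cardinal) + τ := by push_cast; rfl
    _ ≤ ratRank O + residueTrdeg K O hk := add_le_add hE hF


/-! ### Residue fields -/

/-- **Separability under a change of presentation** (base along a surjection `f`, top along an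
injection `g`, compatibly): if `g z` is separable over `B` then `z` is separable over `A`
(the minimal polynomial of `g z` descends along `f` to a separable polynomial killing `z`).
[folklore] -/
theorem isSeparable_of_ringHom_of_comp_eq' {A B S T : Type*} [Field A] [Field B] [Field S]
    [Field T] [Algebra A S] [Algebra B T] (f : A →+* B) (hf : Function.Surjective f)
    (g : S →+* T) (h : (algebraMap B T).comp f = g.comp (algebraMap A S)) {z : S}
    (hz : IsSeparable B (g z)) : IsSeparable A z := by
  obtain ⟨p, hp⟩ := Polynomial.map_surjective f hf (minpoly B (g z))
  have hpz : aeval z p = 0 := by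
    apply g.injective
    rw [map_zero, Polynomial.map_aeval_eq_aeval_map h, hp, minpoly.aeval]
  have hpsep : p.Separable := by
    rw [← Polynomial.separable_map f, hp]
    exact hz
  exact hpsep.of_dvd (minpoly.dvd A z hpz)

/-- Separability over an intermediate field `L` from separability of the image over `L.map ψ`,
for an algebra homomorphism `ψ` of fields. [folklore] -/
theorem isSeparable_of_map_algHom {k A B : Type*} [Field k] [Field A] [Field B] [Algebra k A]
    [Algebra k B] (ψ : A →ₐ[k] B) (L : IntermediateField k A) {z : A}
    (h : IsSeparable (L.map ψ) (ψ z)) : IsSeparable L z :=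
  isSeparable_of_ringHom_of_comp_eq' ((L.equivMap ψ : L ≃ₐ[k] L.map ψ) : L →+* L.map ψ)
    (L.equivMap ψ).surjective (ψ : A →+* B) (RingHom.ext fun _ => rfl) h

variable {V} in
/-- The residue map `κ(O_V ∩ M) → κ(O_V)` on residues. [folklore] -/
theorem residueFieldComapAlgHom_residue {k : Type u} [Field k] [Algebra k Ω]
    (hk : ∀ c : k, algebraMap k Ω c ∈ V) {M : Type u} [Field M] [Algebra M Ω] [Algebra k M]
    [IsScalarTower k M Ω] (hkM : ∀ c : k, algebraMap k M c ∈ V.comap (algebraMap M Ω))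
    (z : V.comap (algebraMap M Ω)) :
    letI := algebraOfMem k V hk
    letI := algebraOfMem k (V.comap (algebraMap M Ω)) hkM
    residueFieldComapAlgHom k V hk hkM (residue _ z) = residue V (comapInclusion V z) := by
  letI := algebraOfMem k V hk
  letI := algebraOfMem k (V.comap (algebraMap M Ω)) hkM
  show ResidueField.map (comapInclusion V) (residue _ z) = _
  rw [ResidueField.map_residue]

/-- **The residue field of `F` in the two renderings.** For an intermediate field `M` of `Ω|K`
with the same elements as `F`, the image of `κ(O_V ∩ M) → κ(O_V)` is `resField V F`.
[folklore] -/
theorem mem_resField_iff_exists_residueFieldComapAlgHom (M : IntermediateField K Ω)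
    (hMF : ∀ z, z ∈ M ↔ z ∈ F) (hKV : (K : Set Ω) ⊆ V) (r : ResidueField V) :
    letI := algebraOfMem K V (algebraMap_subfield_mem_of_subset V hKV)
    letI := algebraOfMem K (V.comap (algebraMap M Ω))
      (algebraMap_mem_comap_intermediateField V M hKV)
    r ∈ resField V F ↔
      ∃ z, residueFieldComapAlgHom K V (algebraMap_subfield_mem_of_subset V hKV)
        (algebraMap_mem_comap_intermediateField V M hKV) z = r := by
  letI := algebraOfMem K V (algebraMap_subfield_mem_of_subset V hKV)
  letI := algebraOfMem K (V.comap (algebraMap M Ω))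
    (algebraMap_mem_comap_intermediateField V M hKV)
  constructor
  · intro hr
    obtain ⟨a, haF, rfl⟩ := (mem_resField_iff V F r).mp hr
    refine ⟨residue _ ⟨⟨(a : Ω), (hMF _).mpr haF⟩, ValuationSubring.mem_comap.mpr a.2⟩,
      ?_⟩
    rw [residueFieldComapAlgHom_residue]
    rfl
  · rintro ⟨z, rfl⟩
    obtain ⟨z, rfl⟩ := IsLocalRing.residue_surjective z
    rw [residueFieldComapAlgHom_residue]
    exact residue_mem_resField V _ ((hMF _).mp (z : M).2)

/-- **A separating transcendence basis of the residue field, in the type rendering.** If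
`FP|KP` is separably generated (`SeparablyGeneratedOver (resField V K) (resField V F)`), then
the residue field of `O_V ∩ M` (`M` an intermediate field with the elements of `F`, `K ⊆ O_V`)
has a finite transcendence basis over `K` over which it is separable. [folklore] -/
theorem exists_isTranscendenceBasis_residueField_of_separablyGeneratedOver
    (M : IntermediateField K Ω) (hMF : ∀ z, z ∈ M ↔ z ∈ F) (hKV : (K : Set Ω) ⊆ V)
    (hsep : SeparablyGeneratedOver (resField V K) (resField V F)) :
    letI := algebraOfMem K (V.comap (algebraMap M Ω))
      (algebraMap_mem_comap_intermediateField V M hKV)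
    ∃ s : Finset (ResidueField (V.comap (algebraMap M Ω))),
      IsTranscendenceBasis K ((↑) : s → ResidueField (V.comap (algebraMap M Ω))) ∧
      ∀ z : ResidueField (V.comap (algebraMap M Ω)),
        IsSeparable
          (IntermediateField.adjoin K (s : Set (ResidueField (V.comap (algebraMap M Ω))))) z := by
  classical
  have hk := algebraMap_mem_comap_intermediateField V M hKV
  have hKV' : ∀ c : K, algebraMap K Ω c ∈ V := algebraMap_subfield_mem_of_subset V hKV
  letI := algebraOfMem K V hKV'
  letI := algebraOfMem K (V.comap (algebraMap M Ω)) hk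
  let ψ := residueFieldComapAlgHom K V hKV' hk
  obtain ⟨t, htF, hind, hsept⟩ := hsep
  -- preimages of the elements of `t`
  have hpre : ∀ i : Fin t.card, ∃ z, ψ z = ((t.equivFin.symm i : t) : ResidueField V) :=
    fun i => (mem_resField_iff_exists_residueFieldComapAlgHom V M hMF hKV _).mp
      (htF (t.equivFin.symm i).2)
  choose g hg using hpre
  -- the base change `K → resField V K`
  obtain ⟨φ, -, hφs, hφ, -⟩ :=
    exists_residue_ringHoms V K (F := K) le_rfl (fun z hz => hKV hz)
  have hφcomp : (algebraMap (resField V K) (ResidueField V)).comp φ =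
      (RingHom.id _).comp (algebraMap K (ResidueField V)) := RingHom.ext fun c => hφ c
  have hφ' : ∀ c : K, algebraMap K (ResidueField V) c = (φ c : ResidueField V) :=
    fun c => (hφ c).symm
  have hrangeK : Set.range (algebraMap K (ResidueField V)) =
      (resField V K : Set (ResidueField V)) := by
    ext r
    constructor
    · rintro ⟨c, rfl⟩
      rw [hφ' c]
      exact (φ c).2
    · intro hr
      obtain ⟨c, hc⟩ := hφs ⟨r, hr⟩
      exact ⟨c, by rw [hφ' c, hc]⟩
  -- `K(t)` over `K` and over `resField V K` have the same elements
  have hmemt : ∀ w : ResidueField V,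
      w ∈ IntermediateField.adjoin (resField V K) (t : Set (ResidueField V)) ↔
        w ∈ IntermediateField.adjoin K (t : Set (ResidueField V)) := by
    intro w
    rw [← IntermediateField.mem_toSubfield, ← IntermediateField.mem_toSubfield,
      IntermediateField.adjoin_toSubfield, IntermediateField.adjoin_toSubfield, hrangeK,
      range_algebraMap_subfield]
  -- (a) `g` is algebraically independent over `K`
  have hψg : ⇑ψ ∘ g = fun i => ((t.equivFin.symm i : t) : ResidueField V) := funext hg
  have hranget : Set.range (⇑ψ ∘ g) = (t : Set (ResidueField V)) := by
    rw [hψg]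
    ext w
    constructor
    · rintro ⟨i, rfl⟩
      exact (t.equivFin.symm i).2
    · intro hw
      exact ⟨t.equivFin ⟨w, hw⟩, by simp⟩
  have hindK : AlgebraicIndependent K (⇑ψ ∘ g) := by
    rw [hψg]
    refine AlgebraicIndependent.of_ringHom_of_comp_eq φ (RingHom.id _) ?_ φ.injective hφcomp
    exact hind.comp _ t.equivFin.symm.injective
  have hindg : AlgebraicIndependent K g := AlgebraicIndependent.of_comp ψ hindK
  -- (b) every residue is separable over `K(g)`
  have hsepg : ∀ z : ResidueField (V.comap (algebraMap M Ω)),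
      IsSeparable (IntermediateField.adjoin K (Set.range g)) z := by
    intro z
    have hz : ψ z ∈ resField V F :=
      (mem_resField_iff_exists_residueFieldComapAlgHom V M hMF hKV _).mpr ⟨z, rfl⟩
    have h1 : IsSeparable (IntermediateField.adjoin K (t : Set (ResidueField V))) (ψ z) := by
      let f₁ : IntermediateField.adjoin (resField V K) (t : Set (ResidueField V)) →+*
          IntermediateField.adjoin K (t : Set (ResidueField V)) :=
        { toFun := fun w => ⟨w, (hmemt w).mp w.2⟩
          map_one' := rfl
          map_mul' := fun _ _ => rfl
          map_zero' := rfl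
          map_add' := fun _ _ => rfl }
      exact isSeparable_of_ringHom_comp_eq f₁ (RingHom.ext fun _ => rfl) (hsept _ hz)
    have hmap : (IntermediateField.adjoin K (Set.range g)).map ψ =
        IntermediateField.adjoin K (t : Set (ResidueField V)) := by
      rw [IntermediateField.adjoin_map, ← Set.range_comp, hranget]
    refine isSeparable_of_map_algHom ψ _ ?_
    rw [hmap]
    exact h1
  -- (c) the transcendence basis, indexed by the finite set `s := image of g`
  let s : Finset (ResidueField (V.comap (algebraMap M Ω))) := Finset.univ.image g
  have hidx : ∀ w : s, ∃ i, g i = w := fun w => by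
    obtain ⟨i, -, hi⟩ := Finset.mem_image.mp w.2
    exact ⟨i, hi⟩
  choose idx hidx using hidx
  have hval : ((↑) : s → ResidueField (V.comap (algebraMap M Ω))) = g ∘ idx :=
    funext fun w => (hidx w).symm
  have hidxinj : Function.Injective idx := fun w w' h =>
    Subtype.ext (by rw [← hidx w, ← hidx w', h])
  have hs : AlgebraicIndependent K ((↑) : s → ResidueField (V.comap (algebraMap M Ω))) := by
    rw [hval]
    exact hindg.comp idx hidxinj
  have hcoe : (s : Set (ResidueField (V.comap (algebraMap M Ω)))) = Set.range g := by
    simp [s]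
  have hsepS : ∀ S : Set (ResidueField (V.comap (algebraMap M Ω))), S = Set.range g →
      ∀ z : ResidueField (V.comap (algebraMap M Ω)),
        IsSeparable (IntermediateField.adjoin K S) z := by
    rintro S rfl; exact hsepg
  refine ⟨s, ?_, hsepS _ hcoe⟩
  refine hs.isTranscendenceBasis_iff_isAlgebraic.mpr ?_
  have key : ∀ S : Set (ResidueField (V.comap (algebraMap M Ω))), S = Set.range g →
      Algebra.IsAlgebraic (Algebra.adjoin K S) (ResidueField (V.comap (algebraMap M Ω))) := by
    rintro S rfl
    exact IntermediateField.isAlgebraic_adjoin_iff_top.mp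
      ⟨fun z => (hsepg z).isIntegral.isAlgebraic⟩
  exact key _ (by rw [Subtype.range_coe]; exact hcoe)

end Bridge

/-! ## Knaf–Kuhlmann 2005, Thm. 3.4 from the Generalized Stability Theorem -/

/-- Closure bookkeeping: `closure (closure S ∪ T) = closure (S ∪ T)`. [folklore] -/
theorem Subfield.closure_closure_union (S T : Set Ω) :
    Subfield.closure ((Subfield.closure S : Set Ω) ∪ T) = Subfield.closure (S ∪ T) := by
  rw [Subfield.closure_union, Subfield.closure_union, Subfield.closure_eq]

/-- **Knaf–Kuhlmann 2005, Thm. 3.4 (for a `K`-trivial place, Hensel-root form) from the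
Generalized Stability Theorem** (KK05 Thm. 3.1 = Kuhlmann 2010, Thm. 1.1, the tree's named fact
`Kuhlmann2010Stability`). PROVED: `Kuhlmann2010Stability → KnafKuhlmann2005_Thm34_henselRoot`.
The printed proof (KK05 p. 7: choose `x` with `v_P F = ⊕ ℤ v_P xᵢ` and `y` with `y P` a separating
transcendence basis of `FP|KP` — Cor. 2.2 —, `F₀ := K(x, y)`; "`(F₀|K,P)` is without
transcendence defect … Hence we know from Theorem 3.1 that `(F₀(η),P)` is a defectless field",
and `F` lies in the absolute inertia field of `F₀`) is run in the type rendering of the tree: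
`F` becomes an intermediate field `M` of `Ω|K` with `D_{M/K} = 0`
(`transcendenceDefect_comap_eq_zero_of_isAbhyankarPlace`, KK05 Thm. 2.1), the residue field of
`O_V ∩ M` is separably generated over `K`
(`exists_isTranscendenceBasis_residueField_of_separablyGeneratedOver`), an adapted Abhyankar
basis `(x, y)` (`|x|` a basis of `vF`, `yP` the separating transcendence basis;
`exists_adapted_isAbhyankarBasis`) makes `K(x, y)` a defectless field by the stability theorem
with `vK(x,y) = vF` and `FP|K(x,y)P` separable, whence a generator `η ∈ O_F` of `F|K(x, y)` whose
minimal polynomial over `O_{K(x,y)}` has unit derivative at `η`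
(`Temkin2013_Thm551iii_inertial.of_stability`, `exists_generator_valuation_derivative_eq_one`);
the data are then read back in `Ω`. [cite: KnafKuhlmann2005, Thm. 3.4 and its proof (p. 7)] -/
theorem KnafKuhlmann2005_Thm34_henselRoot.of_stability (hS : Kuhlmann2010Stability.{u}) :
    KnafKuhlmann2005_Thm34_henselRoot.{u} := by
  intro Ω _ V K F hKF hfg hKV hA hsep
  classical
  -- `F` as an intermediate field `M` of `Ω|K`, and `O := O_V ∩ M`
  obtain ⟨s₀, hs₀⟩ := hfg
  set M : IntermediateField K Ω := IntermediateField.adjoin K (s₀ : Set Ω) with hM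
  have hMF : ∀ z : Ω, z ∈ M ↔ z ∈ F := fun z => by
    rw [hM, mem_adjoin_subfield_iff, hs₀]
  have hfgM : (⊤ : IntermediateField K M).FG :=
    IntermediateField.fg_top_iff.mpr
      (IntermediateField.essFiniteType_iff.mpr (IntermediateField.fg_adjoin_finset s₀))
  have hk : ∀ c : K, algebraMap K M c ∈ V.comap (algebraMap M Ω) :=
    algebraMap_mem_comap_intermediateField V M hKV
  have hKV' : ∀ c : K, algebraMap K Ω c ∈ V := algebraMap_subfield_mem_of_subset V hKV
  set O := V.comap (algebraMap M Ω) with hO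
  have hD : transcendenceDefect K O hk = 0 :=
    transcendenceDefect_comap_eq_zero_of_isAbhyankarPlace V M hMF hKV hfgM hA
  letI := algebraOfMem K O hk
  letI := algebraOfMem K V hKV'
  -- a separating transcendence basis of the residue field, an adapted Abhyankar basis, and the
  -- Hensel-root generator
  obtain ⟨s, hs, hseps⟩ :=
    exists_isTranscendenceBasis_residueField_of_separablyGeneratedOver V M hMF hKV hsep
  obtain ⟨E, x, y, hB, hgen, hyrange⟩ := exists_adapted_isAbhyankarBasis O hk hfgM hD s hs
  have hsep' : ∀ z : ResidueField O,
      IsSeparable (IntermediateField.adjoin K (Set.range fun i => residue O (y i))) z := by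
    have key : ∀ S : Set (ResidueField O), S = (s : Set (ResidueField O)) →
        ∀ z : ResidueField O, IsSeparable (IntermediateField.adjoin K S) z := by
      rintro S rfl; exact hseps
    exact key _ hyrange
  obtain ⟨η, hηO, htop, f, hfm, hfη, hcoef, -, hder⟩ :=
    Temkin2013_Thm551iii_inertial.of_stability hS K M hfgM O hk hD E s.card x y hB hgen hsep'
  -- the data read in `Ω`
  set x' : Fin E → Ω := fun i => (x i : Ω) with hx'
  set y' : Fin s.card → Ω := fun j => ((y j : M) : Ω) with hy'
  have hy'V : ∀ j, y' j ∈ V := fun j => ValuationSubring.mem_comap.mp (y j).2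
  have hx'0 : ∀ i, x' i ≠ 0 := fun i h =>
    hB.ne_zero i ((map_eq_zero_iff _ (algebraMap M Ω).injective).mp h)
  -- images of the adjunctions
  have himg : Subtype.val '' Set.range (Sum.elim x fun i => (y i : M)) =
      Set.range x' ∪ Set.range y' := by
    rw [← Set.range_comp, Sum.comp_elim, Set.Sum.elim_range]
    rfl
  have himgη : Subtype.val '' (Set.range (Sum.elim x fun i => (y i : M)) ∪ {η}) =
      Set.range x' ∪ Set.range y' ∪ {(η : Ω)} := by
    rw [Set.image_union, himg, Set.image_singleton]
  have hadjη : IntermediateField.adjoin K (Set.range x' ∪ Set.range y' ∪ {(η : Ω)}) = M := by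
    rw [← himgη, ← IntermediateField.lift_adjoin, htop, IntermediateField.lift_top]
  have heval : ∀ p : Polynomial M, (p.map (algebraMap M Ω)).eval (η : Ω) =
      algebraMap M Ω (p.eval η) := fun p => by
    rw [Polynomial.eval_map]
    exact Polynomial.eval₂_hom (algebraMap M Ω) η
  refine ⟨E, s.card, x', y', hy'V, fun i => ⟨(hMF _).mp (x i).2, hx'0 i⟩,
    fun j => (hMF _).mp (y j : M).2, ?_, ?_, (η : Ω), ValuationSubring.mem_comap.mp hηO,
    f.map (algebraMap M Ω), ?_, hfm.map _, fun k => ?_, ?_, ?_⟩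
  · -- `ℤ`-independence of the values modulo `vK = 1`
    have hvi : IsValueIndependent V x' :=
      (isValueIndependent_comap_iff V x).mp
        ((isValueIndependent_iff_linearIndependent O x hB.ne_zero).mpr hB.linearIndependent)
    rintro m ⟨b, hbK, hb⟩
    have hb0 : b ≠ 0 := by
      rintro rfl
      rw [map_zero] at hb
      exact (Finset.prod_ne_zero_iff.mpr fun i _ =>
        zpow_ne_zero _ (valuation_ne_zero_of_ne_zero V (hx'0 i))) hb
    have hb1 : V.valuation b = 1 :=
      valuation_eq_one_of_subfield_subset V (F := K) (fun z hz => hKV hz) hbK hb0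
    have hprod : V.valuation (∏ i ∈ Finset.univ, x' i ^ m i) = 1 := by
      rw [map_prod]
      simp_rw [map_zpow₀]
      rw [hb, hb1]
    funext i
    exact hvi.2 Finset.univ m hprod i (Finset.mem_univ i)
  · -- algebraic independence of the residues over `KP`
    let ψ := residueFieldComapAlgHom K V hKV' hk
    have h1 : AlgebraicIndependent K fun i => residue O (y i) := hB.algebraicIndependent_residue
    have h2 : AlgebraicIndependent K (⇑ψ ∘ fun i => residue O (y i)) :=
      h1.map ψ.toRingHom.injective.injOn
    have h3 : (⇑ψ ∘ fun i => residue O (y i)) = fun j => residue V ⟨y' j, hy'V j⟩ := by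
      funext j
      simp only [Function.comp_apply]
      rw [residueFieldComapAlgHom_residue]
      rfl
    obtain ⟨φ, -, hφs, hφ, -⟩ := exists_residue_ringHoms V K (F := K) le_rfl (fun z hz => hKV hz)
    have hφcomp : (algebraMap (resField V K) (ResidueField V)).comp φ =
        (RingHom.id _).comp (algebraMap K (ResidueField V)) := RingHom.ext fun c => hφ c
    have h4 := h2.ringHom_of_comp_eq φ (RingHom.id _) hφs (RingHom.id _).injective hφcomp
    rwa [RingHom.coe_id, Function.id_comp, h3] at h4
  · -- `F = K(x', y')(η)`
    rw [Subfield.closure_closure_union, Set.union_assoc]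
    ext z
    rw [← mem_adjoin_subfield_iff, hadjη]
    exact hMF z
  · -- coefficients in `O_V ∩ K(x', y')`
    rw [Polynomial.coeff_map]
    refine ⟨ValuationSubring.mem_comap.mp (hcoef k).2, ?_⟩
    rw [← mem_adjoin_subfield_iff, ← himg, ← IntermediateField.lift_adjoin]
    exact (IntermediateField.mem_lift (f.coeff k)).mpr (hcoef k).1
  · -- `f(η) = 0`
    rw [heval, hfη, map_zero]
  · -- `v(f'(η)) = 1`
    rw [Polynomial.derivative_map, heval]
    exact (valuation_comap_eq_one_iff V _).mp hder

/-! ## Corollaries: KK05 Thm. 3.4 (standard-étale form), KK05 Thm. 1.1, KK09 Thm. 1.2 -/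

/-- **KK05 Thm. 3.4 in the standard-étale rendering of §5 from the Generalized Stability
Theorem.** [cite: KnafKuhlmann2005, Thm. 3.4 and Section 5 (p. 12)] -/
theorem KnafKuhlmann2005_Thm34_etale.of_stability (hS : Kuhlmann2010Stability.{u}) :
    KnafKuhlmann2005_Thm34_etale.{u} :=
  KnafKuhlmann2005_Thm34_etale.of_henselRoot (KnafKuhlmann2005_Thm34_henselRoot.of_stability hS)

/-- **Knaf–Kuhlmann 2005, Thm. 1.1 from the Generalized Stability Theorem**: the trust base of
the named fact `KnafKuhlmann2005_Thm11` is `{Kuhlmann2010Stability}` (Thm. 3.4 by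
`KnafKuhlmann2005_Thm34_henselRoot.of_stability`, §5 Lemma 5.1 and §4 Thm. 4.1 by
`KnafKuhlmann2005_Thm11.of_parts`). [cite: KnafKuhlmann2005, Thm. 1.1 and its proof (p. 13)] -/
theorem KnafKuhlmann2005_Thm11.of_stability (hS : Kuhlmann2010Stability.{u}) :
    KnafKuhlmann2005_Thm11.{u} :=
  KnafKuhlmann2005_Thm11.of_henselRoot (KnafKuhlmann2005_Thm34_henselRoot.of_stability hS)

/-- **KK05 Thm. 1.1 from the rational case of the stability theorem**
(`Kuhlmann2010StabilityRational`, via `Kuhlmann2010Stability.of_rational`).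
[cite: KnafKuhlmann2005, Thm. 1.1] -/
theorem KnafKuhlmann2005_Thm11.of_stabilityRational
    (hR : Kuhlmann2010StabilityRational.{u}) : KnafKuhlmann2005_Thm11.{u} :=
  KnafKuhlmann2005_Thm11.of_stability (Kuhlmann2010Stability.of_rational hR)

/-- **KK05 Thm. 1.1 from Kuhlmann's Thm. 1.1 in transcendence degree one with a
value-transcendental generator** (`Kuhlmann2010StabilityValueTranscendental`, via
`Kuhlmann2010Stability.of_stabilityValueTranscendental`). [cite: KnafKuhlmann2005, Thm. 1.1] -/
theorem KnafKuhlmann2005_Thm11.of_stabilityValueTranscendental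
    (hVT : Kuhlmann2010StabilityValueTranscendental.{u}) : KnafKuhlmann2005_Thm11.{u} :=
  KnafKuhlmann2005_Thm11.of_stability (Kuhlmann2010Stability.of_stabilityValueTranscendental hVT)

/-- **Knaf–Kuhlmann 2009, Thm. 1.2 (as printed) from henselian rationality and the Generalized
Stability Theorem**: trust base `{KnafKuhlmann2009_Thm38_sepClosed, Kuhlmann2010Stability}`.
[cite: KnafKuhlmann2009, Thm. 1.2] -/
theorem KnafKuhlmann2009_Thm12.of_thm38_stability (h38 : KnafKuhlmann2009_Thm38_sepClosed.{u})
    (hS : Kuhlmann2010Stability.{u}) : KnafKuhlmann2009_Thm12.{u} :=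
  KnafKuhlmann2009_Thm12.of_henselRoots h38 (KnafKuhlmann2005_Thm34_henselRoot.of_stability hS)

/-- **The named fact `KnafKuhlmann2009` from henselian rationality and the Generalized
Stability Theorem**: trust base `{KnafKuhlmann2009_Thm38_sepClosed, Kuhlmann2010Stability}`.
[cite: KnafKuhlmann2009, Thm. 1.2] -/
theorem KnafKuhlmann2009.of_thm38_stability (h38 : KnafKuhlmann2009_Thm38_sepClosed.{u})
    (hS : Kuhlmann2010Stability.{u}) : KnafKuhlmann2009.{u} :=
  KnafKuhlmann2009.of_henselRoots h38 (KnafKuhlmann2005_Thm34_henselRoot.of_stability hS)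

end Literature.AlgebraicGeometry.Resolution

end
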